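import Summits.Parity.GeneralizedHardyLittlewood.Theorems.LeeYangFibresCellParityLawSieveDefs
import Literature.NumberTheory.Sieve.RoughCellDensity
import HarnessLib

/-!
# Route `LeeYangFibres`, crux `CellParityLaw` (stmt-Parity-14109), line `section-annihilator`:
# kernel vocabulary for the `u ≥ 3` rung (skeleton v13)

Route-posited objects and statement types (D-0016 `<Route><Crux>…Defs` file; companion of
`LeeYangFibresCellParityLawDefs.lean` and `…SieveDefs.lean`). NOTHING IS ASSERTED: every `def … : Prop` is
the type of a registered stub of skeleton v13 (`Cruxes/CellParityLaw/Lines/section_annihilator.lean`,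
continuation lead `prover-line-stmt-Parity-14109-c2-0`), and the only theorem is bookkeeping in those
statements (`stub_geThreeCompose`, pure logic).

## Why (lead c2, 2026-08-16)

After v12 the crux is closed modulo the atom `stub_sectionLevel` and the `u ≥ 3` rung
`stub_prLawGeThree : ∀ t ≥ 1, SectionLevelAt t → ∀ u ≥ 3, SectionPrLawAtU u t` — Bombieri's one-parameter
`P_r`/`Ω`-cell law for the section sequences from their level of distribution, with EFFECTIVE relative
accuracy `(log log N)^{-B}` (the Walsh induction consumes every `B`). v13 splits that rung into

* ONE abstract, crux-independent ANALYTIC KERNEL `EffectiveRoughCellLaw` (type of `stub_roughCellKernel`):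
  the effective — polynomial-rate — form of Bombieri's asymptotic-sieve completeness theorem for the rough
  `Ω`-cells of a single sifted sequence at finite level, stated in the tree's `SieveSequence` vocabulary
  (weights `≤ 1` supported on `(x/Λ, x]`, size = counting function, multiplicative density of dimension
  `Ω(1, L')` bounded by `A₁/p` with a two-sided Mertens product above `w₀`, Type-I remainders of ALL
  truncations at level `x^{1-η}`; output: ONE `δ ∈ [0, 2]` with
  `C_m = (1 + (δ-1)(-1)^m) · (I_m(u')/u') · e^γ V(z) · A(x) + O((η^κ + (log z)^{-κ} + log(2Λ)/log z) V(z) A(x))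
   + O((log x)^{A₂} R)` for every `m ≥ 1`, `u' = log x/log z`, `I_m = roughCellDensity m`). Printed
  technology (Friedlander–Iwaniec, Pisa 1978 §4: `Λ_(k)` asymptotics with relative error `O_k(δ^{1/3})`
  from level `x^{1-δ}`; Bombieri, RIMS 294 (1977) p. 5: the `P_r` law, QUALITATIVE, by moments and
  Stone–Weierstrass) gives only a logarithmic rate `(log 1/η)^{-1/2}`; the polynomial rate is plausible
  (FI's dissection with Mellin-twisted smooth cut-offs) and UNPUBLISHED — this is the honest research
  content of the crux once the atom is granted, isolated so that it can be promoted / attacked / reused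
  (`RoughSemiprimeRigidity.BombieriRoughP2Law` consumes the same law qualitatively);
* PROVABLE GLUE: the section sequence in Bombieri's normalisation (`secSeqB`: size = counting function, so
  that truncated remainders are the atom's discrepancies on the convex bodies `K ∩ {ψ_i ≤ y}`), its
  identities (`SectionSeqBFacts`, `SectionSeqBCells`), the lower dimension bound (`SectionDimensionLow`),
  the two-sided sharp Mertens evaluation `e^γ V(N^{1/u}) = u H/log N (1 + O(1/log N))`
  (`SectionMertensLowerHead`, `SectionMertensTwo`), Alladi's densities `a_m = I_m(u)/log N + O(1/log² N)`
  (`ModelDensityAlladi`), the kernel application (`GeThreeReduce`, output `RawSectionLawAt`) and the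
  assembly (`GeThreeAssembly`: localisation `K ∩ {ψ_i > x/Λ}`, small-mass and degenerate cases).

References: E. Bombieri, Rend. Accad. Naz. XL (5) 1/2 (1975/76) 243–269 [BombieriAsymptoticSieve1976];
E. Bombieri, RIMS Kôkyûroku 294 (1977) p. 5 [BombieriRIMS1977]; J. Friedlander, H. Iwaniec, Ann. Sc.
Norm. Sup. Pisa (4) 5 (1978) 719–756, §4 [FriedlanderIwaniecPisa1978]; K. Ford, Trans. AMS 357 (2005)
1663–1674 [Ford2004]; K. Alladi, Quart. J. Math. 33 (1982) Thm 1 [Alladi1982]; H. Iwaniec, Acta Arith.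
36 (1980) Thm 1 [IwaniecActaArith1980].
-/

noncomputable section

open scoped BigOperators Classical
open Finset Literature.NumberTheory.Sieve

namespace Summit.Parity.GeneralizedHardyLittlewood.Cruxes.CellParityLaw.SectionAnnihilator

/-! ## The kernel: an effective Bombieri law for the rough `Ω`-cells of ONE sifted sequence -/

/-- **The rough `Ω`-cells of a sifted sequence**: `C_m(𝒜; x, z) = ∑_{q ≤ x, P⁻(q) > z, Ω(q) = m} a_q`
(threshold strict and real, as in the crux's `cell`). -/
def roughCellSum (𝒜 : SieveSequence) (x z : ℝ) (m : ℕ) : ℝ :=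
  ∑ q ∈ (Finset.Ioc 0 ⌊x⌋₊).filter
      (fun q => z < (Nat.minFac q : ℝ) ∧ ArithmeticFunction.cardFactors q = m), 𝒜.a q

/-- **Effective rough-cell law** (`EffectiveRoughCellLaw`; type of the KERNEL stub `stub_roughCellKernel` —
the research content of the `u ≥ 3` rung, crux-independent). For every roughness `u ≥ 2` and density
parameters `A₁, L'` there are a RATE EXPONENT `κ > 0`, a constant `C`, a log-power `A₂` and a threshold
`x₀` such that: for every sifted sequence `𝒜` and reals `x ≥ x₀`, `z ∈ [x^{1/(u+1)}, x^{1/u}]`,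
`η ∈ [(log x)^{-1/2}, 1/(4u)]`, `Λ, w₀ ∈ [·, x^η]`, `R`, IF
(weights) `0 ≤ a_q ≤ 1`, `a_q = 0` unless `x/Λ < q ≤ x`; (size) `𝒜.size` is the counting function and
`A(x) ≥ x^{1-1/(4u)}`; (density) `g(p) ≤ A₁/p`, `g` has Iwaniec dimension `Ω(1, L')`, and the two-sided
Mertens bound `∏_{w ≤ p < z'} (1-g(p))⁻¹ ≥ (log z'/log w)(1 - L'/log w)` holds for `w₀ ≤ w ≤ z' ≤ x`;
(Type I) `∑_{d ≤ x^{1-η}, d squarefree} |A_d(y) - g(d) A(y)| ≤ R` for EVERY truncation `y ≤ x` —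
THEN there is ONE `δ ∈ [0, 2]` such that for every `m ≥ 1`
`|C_m(𝒜; x, z) - (1 + (δ-1)(-1)^m) (I_m(u')/u') e^γ V(z) A(x)|
   ≤ C (η^κ + (log z)^{-κ} + log(2Λ)/log z) V(z) A(x) + C (log x)^{A₂} R`,
`u' = log x/log z`, `I_m = roughCellDensity m` (Alladi–Buchstab densities), `V(z) = ∏_{p<z}(1 - g(p))`.
(For `a ≡ 1` on `(x/Λ, x]`: `δ = 1`, Alladi. For `a = 1 + (1-δ₀)λ`: `δ = δ₀`. The one free parameter is
Bombieri's `δ_x`; `m` odd carries `2 - δ`, `m` even carries `δ`.) Polynomial rate in the level deficit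
`η` is what the line's `(log log N)^{-B}` budgets require (`η = 2(log log N)^{-B₂}`, `B₂ = ⌈(B+…)/κ⌉`);
printed methods give `(log 1/η)^{-1/2}`. A research statement, not a fact. -/
def EffectiveRoughCellLaw : Prop :=
  ∀ (u : ℕ) (A₁ L' : ℝ), 2 ≤ u → ∃ (κ C : ℝ) (A₂ : ℕ) (x₀ : ℝ), 0 < κ ∧ 0 ≤ C ∧
    ∀ (𝒜 : SieveSequence) (x z η Λ w₀ R : ℝ), x₀ ≤ x →
      x ^ (1 / ((u : ℝ) + 1)) ≤ z → z ≤ x ^ (1 / (u : ℝ)) →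
      Real.log x ^ (-(1 / 2 : ℝ)) ≤ η → η ≤ 1 / (4 * (u : ℝ)) →
      1 ≤ Λ → Λ ≤ x ^ η → 2 ≤ w₀ → w₀ ≤ x ^ η →
      (∀ q : ℕ, 𝒜.a q ≤ 1) → (∀ q : ℕ, x < (q : ℝ) → 𝒜.a q = 0) → (∀ q : ℕ, (q : ℝ) ≤ x / Λ → 𝒜.a q = 0) →
      (∀ y : ℝ, 𝒜.size y = 𝒜.congrSum 1 y) → x ^ (1 - 1 / (4 * (u : ℝ))) ≤ 𝒜.size x →
      (∀ p : ℕ, p.Prime → 𝒜.density p ≤ A₁ / p) → HasIwaniecDimension 𝒜.density 1 L' →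
      (∀ w z' : ℝ, w₀ ≤ w → w ≤ z' → z' ≤ x →
          Real.log z' / Real.log w * (1 - L' / Real.log w) ≤
            ∏ p ∈ (Nat.primesBelow ⌈z'⌉₊).filter (fun p : ℕ => w ≤ (p : ℝ)), (1 - 𝒜.density p)⁻¹) →
      (∀ y : ℝ, y ≤ x →
          ∑ d ∈ (Finset.Icc 1 ⌊x ^ (1 - η)⌋₊).filter Squarefree, |𝒜.remainder d y| ≤ R) →
      ∃ δ : ℝ, 0 ≤ δ ∧ δ ≤ 2 ∧ ∀ m : ℕ, 1 ≤ m →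
        |roughCellSum 𝒜 x z m -
            (1 + (δ - 1) * (-1 : ℝ) ^ m) *
              (roughCellDensity m (Real.log x / Real.log z) / (Real.log x / Real.log z)) *
              (Real.exp Real.eulerMascheroniConstant * 𝒜.densityProduct (primesProdBelow z)) * 𝒜.size x|
          ≤ C * (η ^ κ + Real.log z ^ (-κ) + Real.log (2 * Λ) / Real.log z) *
                (𝒜.densityProduct (primesProdBelow z) * 𝒜.size x) +
              C * Real.log x ^ A₂ * R

/-! ## The section sequence in Bombieri's normalisation -/

/-- **The section sequence with counting-function size** (`secSeqB`): weights `b(q) = sectionWeight … q`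
(lattice points of the fibre `ψ_i = q` with the other forms frozen in their rough `Ω`-cells), size
`A(y) = ∑_{q ≤ y} b(q)` (Bombieri's normalisation, so that `A.size y = A.congrSum 1 y` and the TRUNCATED
remainders `A_d(y) - g(d) A(y)` are the atom's discrepancies on the convex body `K ∩ {ψ_i ≤ y}`), density
the section density `g = sectionDensityFn Ψ i`. Compare `sectionSeq … e` (constant size `g(e) F`). -/
def secSeqB {t : ℕ} (Ψ : Fin (t + 1) → AffLinForm 1) (K : Set (Fin 1 → ℝ)) (N u : ℕ)
    (i : Fin (t + 1)) (j' : Fin t → ℕ) : SieveSequence where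
  a q := (sectionWeight Ψ K N u i j' q : ℝ)
  a_nonneg _ := Nat.cast_nonneg _
  size y := ∑ q ∈ Finset.Ioc 0 ⌊y⌋₊, (sectionWeight Ψ K N u i j' q : ℝ)
  density := sectionDensityFn Ψ i
  density_mult := isMultiplicative_sectionDensityFn Ψ i

/-! ## Parameter choices of the kernel application (skeleton v13) -/

/-- Value bound `x = 2LN` (every value of a form of size `≤ L` on `[-N,N]` is `≤ 2LN`). -/
def xOf (L N : ℕ) : ℝ := 2 * (L : ℝ) * N

/-- Cell threshold `z = N^{1/u}` (real, as in the crux's `cell`). -/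
def zOf (N u : ℕ) : ℝ := (N : ℝ) ^ ((1 : ℝ) / u)

/-- Level deficit `η = 2 (log log N)^{-B₂}` (so that `x^{1-η} ≤ N^{1-(log log N)^{-B₂}}`, the atom's level). -/
def etaOf (N B₂ : ℕ) : ℝ := 2 / Real.log (Real.log N) ^ B₂

/-- Support parameter `Λ = (log N)^{t+2}` (the body is localised to `ψ_i > x/Λ`). -/
def lamOf (N t : ℕ) : ℝ := Real.log N ^ (t + 2)

/-- Small-prime cut `w₀ = (log N)²` (above it the section density has two-sided dimension `1`). -/
def wOf (N : ℕ) : ℝ := Real.log N ^ 2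

/-- Type-I saving `R = N/(log N)^A`. -/
def rOf (N A : ℕ) : ℝ := (N : ℝ) / Real.log N ^ A

/-- **Type-I-side identities of `secSeqB`** (`SectionSeqBFacts`; type of `stub_sectionSeqBFacts`), for every
system, body, scale, coordinate and frozen cells: (a) the size is the counting function; (b) the congruence
sums of the truncation at `y` are the section masses over the convex body `K ∩ {ψ_i ≤ y}`; (c) hence the
truncated remainders at `d ≠ 0` are the atom's discrepancies on that body; (d) once `x` bounds every value
of `ψ_i` on the box, `A(x)` is the full fibre mass `F⁽ⁱ⁾_{j'}`; (e) `V(z) = ∏_{p<z}(1 - g(p))`;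
(f) the bodies `K ∩ {ψ_i ≤ y}`, `K ∩ {T < ψ_i}` are convex when `K` is. Elementary. -/
def SectionSeqBFacts : Prop :=
  ∀ (t : ℕ) (Ψ : Fin (t + 1) → AffLinForm 1) (K : Set (Fin 1 → ℝ)) (N u : ℕ) (i : Fin (t + 1))
    (j' : Fin t → ℕ),
    (∀ y : ℝ, (secSeqB Ψ K N u i j').size y = (secSeqB Ψ K N u i j').congrSum 1 y) ∧
    (∀ (d : ℕ) (y : ℝ), (secSeqB Ψ K N u i j').congrSum d y =
        sectionMass Ψ (K ∩ {v | (Ψ i).realEval v ≤ y}) N u i j' d) ∧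
    (∀ (d : ℕ) (y : ℝ), d ≠ 0 → (secSeqB Ψ K N u i j').remainder d y =
        (sectionMass Ψ (K ∩ {v | (Ψ i).realEval v ≤ y}) N u i j' d : ℝ) -
          sectionDensity Ψ i d * (sectionMass Ψ (K ∩ {v | (Ψ i).realEval v ≤ y}) N u i j' 1 : ℝ)) ∧
    (∀ x : ℝ, (∀ n ∈ latticeBox 1 N, (((Ψ i).eval n : ℤ) : ℝ) ≤ x) →
        (secSeqB Ψ K N u i j').size x = sectionMass Ψ K N u i j' 1) ∧
    (∀ z : ℝ, (secSeqB Ψ K N u i j').densityProduct (primesProdBelow z) =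
        ∏ p ∈ Nat.primesBelow ⌈z⌉₊, (1 - sectionDensity Ψ i p)) ∧
    (∀ y : ℝ, Convex ℝ K → Convex ℝ (K ∩ {v | (Ψ i).realEval v ≤ y})) ∧
    (∀ T : ℝ, Convex ℝ K → Convex ℝ (K ∩ {v | T < (Ψ i).realEval v}))

/-- **Weight-side identities of `secSeqB`** (`SectionSeqBCells`; type of `stub_sectionSeqBCells`):
(a) with a non-zero leading coefficient the weights are `≤ 1`; (b) they vanish above every bound of the
values of `ψ_i` on the box and (c) at or below `T` when `K ⊆ {T < ψ_i}`; (d) the kernel's rough cells of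
`secSeqB` at threshold `N^{1/u}` ARE the joint cells `C_{(m,j')}` (`m ≥ 1`) once `x` bounds the values;
(e) localisation costs: passing from `K` to `K ∩ {T < ψ_i}` (`T ≥ 0`) loses at most `T + 1` points from
the cells `C_{(m,j')}` (`m ≥ 1`) and from the fibre mass, and both are monotone in the body. -/
def SectionSeqBCells : Prop :=
  ∀ (t : ℕ) (Ψ : Fin (t + 1) → AffLinForm 1) (K : Set (Fin 1 → ℝ)) (N u : ℕ) (i : Fin (t + 1))
    (j' : Fin t → ℕ),
    ((Ψ i).coeff ≠ 0 → ∀ q : ℕ, (secSeqB Ψ K N u i j').a q ≤ 1) ∧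
    (∀ (x : ℝ) (q : ℕ), (∀ n ∈ latticeBox 1 N, (((Ψ i).eval n : ℤ) : ℝ) ≤ x) → x < (q : ℝ) →
        (secSeqB Ψ K N u i j').a q = 0) ∧
    (∀ (T : ℝ) (q : ℕ), K ⊆ {v | T < (Ψ i).realEval v} → (q : ℝ) ≤ T →
        (secSeqB Ψ K N u i j').a q = 0) ∧
    (∀ x : ℝ, (∀ n ∈ latticeBox 1 N, (((Ψ i).eval n : ℤ) : ℝ) ≤ x) → ∀ m : ℕ, 1 ≤ m →
        roughCellSum (secSeqB Ψ K N u i j') x ((N : ℝ) ^ ((1 : ℝ) / u)) m =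
          cell Ψ K N u (i.insertNth m j')) ∧
    (∀ T : ℝ, 0 ≤ T → (Ψ i).coeff ≠ 0 → ∀ m : ℕ, 1 ≤ m →
        (cell Ψ K N u (i.insertNth m j') : ℝ) ≤
            cell Ψ (K ∩ {v | T < (Ψ i).realEval v}) N u (i.insertNth m j') + (T + 1) ∧
        (sectionMass Ψ K N u i j' 1 : ℝ) ≤
            sectionMass Ψ (K ∩ {v | T < (Ψ i).realEval v}) N u i j' 1 + (T + 1)) ∧
    (∀ K' : Set (Fin 1 → ℝ), K' ⊆ K →
        (∀ j : Fin (t + 1) → ℕ, cell Ψ K' N u j ≤ cell Ψ K N u j) ∧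
        ∀ d : ℕ, sectionMass Ψ K' N u i j' d ≤ sectionMass Ψ K N u i j' d)

/-- **Lower dimension bound of the section densities** (`SectionDimensionLow`; type of
`stub_sectionDimensionLow`): for non-degenerate systems of size `≤ L` and coordinates with no degenerate prime,
(a) `g(p) ≤ (t+2)/p` at every prime (`g(p) ≤ 1/(p - t)` for `p > t`, `g ≤ 1`); (b) above `w₀ = (log N)²`
the Mertens product is bounded BELOW with rate: `∏_{w ≤ p < z'} (1 - g(p))⁻¹ ≥ (log z'/log w)(1 - L₁/log w)`
for `(log N)² ≤ w ≤ z' ≤ 2LN` (non-holes have `g(p) = 1/(p - ν') ≥ 1/p`; the holes divide the cross-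
discriminant `Δ = |a_i| ∏_{k ≠ i} |a_i b_k - a_k b_i| ≠ 0`, `ω(Δ) ≪_{t,L} log N`, so `∏_{holes ≥ w}(1 - 1/p)
≥ 1 - ω(Δ)/w`; Mertens' product with rate for `∏ (1 - 1/p)`). -/
def SectionDimensionLow : Prop :=
  ∀ (t L : ℕ), ∃ L₁ : ℝ, ∃ N₀ : ℕ, ∀ N : ℕ, N₀ ≤ N →
    ∀ Ψ : Fin (t + 1) → AffLinForm 1, IsNondegenerateSystem Ψ → affLinSize Ψ N ≤ L →
    ∀ i : Fin (t + 1), (∀ p : ℕ, p.Prime → sectionDensity Ψ i p < 1) →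
      (∀ p : ℕ, p.Prime → sectionDensity Ψ i p ≤ ((t : ℝ) + 2) / p) ∧
      ∀ w z' : ℝ, Real.log N ^ 2 ≤ w → w ≤ z' → z' ≤ 2 * L * N →
        Real.log z' / Real.log w * (1 - L₁ / Real.log w) ≤
          ∏ p ∈ (Nat.primesBelow ⌈z'⌉₊).filter (fun p : ℕ => w ≤ (p : ℝ)), (1 - sectionDensity Ψ i p)⁻¹

/-- **The head of Bombieri's constant from below** (`SectionMertensLowerHead`; type of
`stub_sectionMertensLowerHead`, companion of the landed `stub_sectionMertensHead`): in the non-degenerate case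
(`𝔖(Ψ₋ᵢ) ≠ 0`), for `m > L`, `m ≥ 2t + 2`, `∏_{p<m} (1 - g(p))/(1 - 1/p) ≥ H_{Ψ,i} (1 - C log N/m)` for
`N ≥ N₀(t, L)` — the tail `∏_{p ≥ m} E_p` exceeds `1` only at the holes of `g` (primes dividing the
cross-discriminant, `ω(Δ) ≤ C log N`), each by `≤ 1 + 1/(p-1)`, so `tail ≤ exp(2 ω(Δ)/m)`. -/
def SectionMertensLowerHead : Prop :=
  ∀ (t L : ℕ), ∃ C : ℝ, 0 ≤ C ∧ ∃ N₀ : ℕ, ∀ N : ℕ, N₀ ≤ N →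
    ∀ Ψ : Fin (t + 1) → AffLinForm 1, IsNondegenerateSystem Ψ → affLinSize Ψ N ≤ L →
    ∀ i : Fin (t + 1), (∀ p : ℕ, p.Prime → sectionDensity Ψ i p < 1) →
      singularProduct (Fin.removeNth i Ψ) ≠ 0 →
      ∀ m : ℕ, L < m → 2 * t + 2 ≤ m →
        sectionH Ψ i * (1 - C * Real.log N / m) ≤
          ∏ p ∈ Nat.primesBelow m, (1 - sectionDensity Ψ i p) / (1 - (p : ℝ)⁻¹)

/-- **Two-sided sharp Mertens evaluation at the cell threshold** (`SectionMertensTwo`; type of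
`stub_sectionMertensTwo`): in the non-degenerate case, at `z = N^{1/u}`,
`|e^γ ∏_{p<z} (1 - g(p)) - u H_{Ψ,i}/log N| ≤ C H_{Ψ,i}/log² N` for `N ≥ N₀(t, L, u)` (Mertens' product
theorem with rate, the landed head bound `stub_sectionMertensHead` and the lower head bound). -/
def SectionMertensTwo : Prop :=
  ∀ (t L u : ℕ), 2 ≤ u → ∃ C : ℝ, ∃ N₀ : ℕ, ∀ N : ℕ, N₀ ≤ N →
    ∀ Ψ : Fin (t + 1) → AffLinForm 1, IsNondegenerateSystem Ψ → affLinSize Ψ N ≤ L →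
    ∀ i : Fin (t + 1), (∀ p : ℕ, p.Prime → sectionDensity Ψ i p < 1) →
      singularProduct (Fin.removeNth i Ψ) ≠ 0 →
      |Real.exp Real.eulerMascheroniConstant *
            ∏ p ∈ Nat.primesBelow ⌈zOf N u⌉₊, (1 - sectionDensity Ψ i p) -
          u * sectionH Ψ i / Real.log N| ≤
        C * sectionH Ψ i / Real.log N ^ 2

/-- **Alladi's densities with rate, and their Lipschitz continuity** (`ModelDensityAlladi`; type of
`stub_modelDensityAlladi`): at fixed `u ≥ 2`, `|a_m - I_m(u)/log N| ≤ C/log² N` for all `m ≥ 1` and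
`N ≥ N₀` (`a_m = modelDensity N u m`, `I_m = roughCellDensity m`; the tree's `exists_abs_roughCell_sub_main_le`
at `Y = ⌊N^{1/u}⌋ + 1`, plus `a_m = I_m(u) = 0` for `m ≥ u`), and `|I_m(v) - I_m(u)| ≤ C (v - u)` for
`u ≤ v ≤ u + 1` (`I_m' = I_{m-1}(v-1)/(v-1) ≤ 1`). -/
def ModelDensityAlladi : Prop :=
  ∀ u : ℕ, 2 ≤ u → ∃ C : ℝ, 0 ≤ C ∧ ∃ N₀ : ℕ,
    (∀ N : ℕ, N₀ ≤ N → ∀ m : ℕ, 1 ≤ m →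
        |modelDensity N u m - roughCellDensity m u / Real.log N| ≤ C / Real.log N ^ 2) ∧
    (∀ m : ℕ, 1 ≤ m → ∀ v : ℝ, (u : ℝ) ≤ v → v ≤ (u : ℝ) + 1 →
        |roughCellDensity m v - roughCellDensity m u| ≤ C * (v - u))

/-- **The raw section law** (`RawSectionLawAt t`, systems of `t + 1` forms; conclusion of the kernel
application `GeThreeReduce`): for a LOCALISED body `K ⊆ {ψ_i > x/Λ}` (`x = 2LN`, `Λ = (log N)^{t+2}`) of
LARGE fibre mass `F ≥ N/log^{t+2} N`, in the case of no degenerate prime, ONE `δ ∈ [0,2]` with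
`|C_{(m,j')} - (1 + (δ-1)(-1)^m)(I_m(u')/u') e^γ V(N^{1/u}) F| ≤ V(N^{1/u}) F/(log log N)^{Bκ} + N/log^{t+2} N`
for every `m ≥ 1` and EVERY `Bκ` (`u' = log x/log N^{1/u}`), `N ≥ N₀(t, L, u, Bκ)`. Kernel currency:
`V = ∏_{p < N^{1/u}} (1 - g(p))`, `I_m = roughCellDensity m`. -/
def RawSectionLawAt (t : ℕ) : Prop :=
  ∀ (L u Bκ : ℕ), 2 ≤ u → ∃ N₀ : ℕ, ∀ N : ℕ, N₀ ≤ N →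
    ∀ Ψ : Fin (t + 1) → AffLinForm 1, IsNondegenerateSystem Ψ → affLinSize Ψ N ≤ L →
    ∀ K : Set (Fin 1 → ℝ), Convex ℝ K → K ⊆ realBox 1 N →
    ∀ i : Fin (t + 1), ∀ j' : Fin t → ℕ, (∀ k, 1 ≤ j' k ∧ j' k ≤ u) →
      (∀ p : ℕ, p.Prime → sectionDensity Ψ i p < 1) →
      K ⊆ {v | xOf L N / lamOf N t < (Ψ i).realEval v} →
      (N : ℝ) / Real.log N ^ (t + 2) ≤ sectionMass Ψ K N u i j' 1 →
      ∃ δ : ℝ, 0 ≤ δ ∧ δ ≤ 2 ∧ ∀ m : ℕ, 1 ≤ m →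
        |(cell Ψ K N u (i.insertNth m j') : ℝ) -
            (1 + (δ - 1) * (-1 : ℝ) ^ m) *
              (roughCellDensity m (Real.log (xOf L N) / Real.log (zOf N u)) /
                (Real.log (xOf L N) / Real.log (zOf N u))) *
              (Real.exp Real.eulerMascheroniConstant *
                ∏ p ∈ Nat.primesBelow ⌈zOf N u⌉₊, (1 - sectionDensity Ψ i p)) *
              (sectionMass Ψ K N u i j' 1 : ℝ)|
          ≤ (∏ p ∈ Nat.primesBelow ⌈zOf N u⌉₊, (1 - sectionDensity Ψ i p)) *
                (sectionMass Ψ K N u i j' 1 : ℝ) / Real.log (Real.log N) ^ Bκ +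
              (N : ℝ) / Real.log N ^ (t + 2)

/-- **The kernel's hypotheses for the localised section sequence** (`KernelReadyAt t`; conclusion of
`GeThreeHyp`): for `N ≥ N₀(t, L, u, A, B₂)`, every non-degenerate system of size `≤ L`, convex body
`K ⊆ [-N,N]` localised to `ψ_i > x/Λ` with fibre mass `≥ N/log^{t+2} N`, coordinate with no degenerate prime
and frozen cells, the sequence `𝒜 = secSeqB Ψ K N u i j'` with the parameters `x = xOf L N`, `z = zOf N u`,
`η = etaOf N B₂`, `Λ = lamOf N t`, `w₀ = wOf N`, `R = rOf N A`, `A₁ = t + 2` and ONE `L' = L'(t, L)` satisfies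
every hypothesis of `EffectiveRoughCellLaw` VERBATIM, and its cells / size / density product are the crux's
`C_{(m,j')}` (`m ≥ 1`), `F⁽ⁱ⁾_{j'}` and `V(N^{1/u})`. -/
def KernelReadyAt (t : ℕ) : Prop :=
  ∀ (L u A B₂ : ℕ), 2 ≤ u → 1 ≤ B₂ → ∃ L' : ℝ, ∃ N₀ : ℕ, ∀ N : ℕ, N₀ ≤ N →
    ∀ Ψ : Fin (t + 1) → AffLinForm 1, IsNondegenerateSystem Ψ → affLinSize Ψ N ≤ L →
    ∀ K : Set (Fin 1 → ℝ), Convex ℝ K → K ⊆ realBox 1 N →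
    ∀ i : Fin (t + 1), ∀ j' : Fin t → ℕ, (∀ k, 1 ≤ j' k ∧ j' k ≤ u) →
      (∀ p : ℕ, p.Prime → sectionDensity Ψ i p < 1) →
      K ⊆ {v | xOf L N / lamOf N t < (Ψ i).realEval v} →
      (N : ℝ) / Real.log N ^ (t + 2) ≤ sectionMass Ψ K N u i j' 1 →
      (xOf L N ^ (1 / ((u : ℝ) + 1)) ≤ zOf N u ∧ zOf N u ≤ xOf L N ^ (1 / (u : ℝ)) ∧
        Real.log (xOf L N) ^ (-(1 / 2 : ℝ)) ≤ etaOf N B₂ ∧ etaOf N B₂ ≤ 1 / (4 * (u : ℝ)) ∧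
        1 ≤ lamOf N t ∧ lamOf N t ≤ xOf L N ^ etaOf N B₂ ∧ 2 ≤ wOf N ∧ wOf N ≤ xOf L N ^ etaOf N B₂) ∧
      (∀ q : ℕ, (secSeqB Ψ K N u i j').a q ≤ 1) ∧
      (∀ q : ℕ, xOf L N < (q : ℝ) → (secSeqB Ψ K N u i j').a q = 0) ∧
      (∀ q : ℕ, (q : ℝ) ≤ xOf L N / lamOf N t → (secSeqB Ψ K N u i j').a q = 0) ∧
      (∀ y : ℝ, (secSeqB Ψ K N u i j').size y = (secSeqB Ψ K N u i j').congrSum 1 y) ∧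
      xOf L N ^ (1 - 1 / (4 * (u : ℝ))) ≤ (secSeqB Ψ K N u i j').size (xOf L N) ∧
      (∀ p : ℕ, p.Prime → (secSeqB Ψ K N u i j').density p ≤ ((t : ℝ) + 2) / p) ∧
      HasIwaniecDimension (secSeqB Ψ K N u i j').density 1 L' ∧
      (∀ w z' : ℝ, wOf N ≤ w → w ≤ z' → z' ≤ xOf L N →
          Real.log z' / Real.log w * (1 - L' / Real.log w) ≤
            ∏ p ∈ (Nat.primesBelow ⌈z'⌉₊).filter (fun p : ℕ => w ≤ (p : ℝ)),
              (1 - (secSeqB Ψ K N u i j').density p)⁻¹) ∧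
      (∀ y : ℝ, y ≤ xOf L N →
          ∑ d ∈ (Finset.Icc 1 ⌊xOf L N ^ (1 - etaOf N B₂)⌋₊).filter Squarefree,
            |(secSeqB Ψ K N u i j').remainder d y| ≤ rOf N A) ∧
      (∀ m : ℕ, 1 ≤ m →
          roughCellSum (secSeqB Ψ K N u i j') (xOf L N) (zOf N u) m = cell Ψ K N u (i.insertNth m j')) ∧
      (secSeqB Ψ K N u i j').size (xOf L N) = sectionMass Ψ K N u i j' 1 ∧
      (secSeqB Ψ K N u i j').densityProduct (primesProdBelow (zOf N u)) =
        ∏ p ∈ Nat.primesBelow ⌈zOf N u⌉₊, (1 - sectionDensity Ψ i p)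

/-- **The kernel hypotheses, verified** (`GeThreeHyp`; type of `stub_geThreeHyp`): the `secSeqB` identities,
the two dimension bounds (`L' := max` of theirs) and the atom (on the convex bodies `K ∩ {ψ_i ≤ y}`, at the
level `N^{1-(log log N)^{-B₂}} ≥ x^{1-η}`, saving `(log N)^{-A}`) give `KernelReadyAt t`; the eight range
conditions hold for `N ≥ N₀`. -/
def GeThreeHyp : Prop :=
  SectionSeqBFacts → SectionSeqBCells → SectionDimension → SectionDimensionLow →
    ∀ t : ℕ, 1 ≤ t → SectionLevelAt t → KernelReadyAt t

/-- **The kernel application** (`GeThreeReduce`; type of `stub_geThreeReduce`): apply `EffectiveRoughCellLaw` at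
`(u, A₁ = t+2, L')` to the ready sequence, with `B₂` chosen so that `κ B₂ ≥ Bκ + 1` and `A = A₂ + t + 3`;
for `N ≥ N₀` the four error terms `C η^κ`, `C (log z)^{-κ}`, `C log(2Λ)/log z` (times `V F`) and
`C (log x)^{A₂} R` are below `V F/(log log N)^{Bκ} + N/log^{t+2} N`, which is `RawSectionLawAt t`. -/
def GeThreeReduce : Prop :=
  EffectiveRoughCellLaw → (∀ t : ℕ, 1 ≤ t → SectionLevelAt t → KernelReadyAt t) →
    ∀ t : ℕ, 1 ≤ t → SectionLevelAt t → RawSectionLawAt t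

/-- **Main-term conversion** (`MainTermConversion`; conclusion of `GeThreeMainTerm`): in the non-degenerate
case, for `N ≥ N₀(t, L, u)`, (a) `e^γ V(N^{1/u}) ≤ C H_{Ψ,i}/log N`, and (b) for every `δ ∈ [0,2]`, `m ≥ 1`
and mass `F' ≥ 0`, the kernel's main term `(1 + (δ-1)(-1)^m)(I_m(u')/u') e^γ V(N^{1/u}) F'`
(`u' = log(2LN)/log N^{1/u}`) differs from the crux's `(1 + (δ-1)(-1)^m) a_m H_{Ψ,i} F'` by at most
`C H_{Ψ,i} F'/log² N` (two-sided Mertens, Alladi with rate, `|I_m(u') - I_m(u)| ≤ C u log(2L)/log N`,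
`I_m ≤ u`). -/
def MainTermConversion : Prop :=
  ∀ (t L u : ℕ), 2 ≤ u → ∃ C : ℝ, 0 ≤ C ∧ ∃ N₀ : ℕ, ∀ N : ℕ, N₀ ≤ N →
    ∀ Ψ : Fin (t + 1) → AffLinForm 1, IsNondegenerateSystem Ψ → affLinSize Ψ N ≤ L →
    ∀ i : Fin (t + 1), (∀ p : ℕ, p.Prime → sectionDensity Ψ i p < 1) →
      singularProduct (Fin.removeNth i Ψ) ≠ 0 →
      Real.exp Real.eulerMascheroniConstant *
            ∏ p ∈ Nat.primesBelow ⌈zOf N u⌉₊, (1 - sectionDensity Ψ i p) ≤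
          C * sectionH Ψ i / Real.log N ∧
      ∀ δ : ℝ, 0 ≤ δ → δ ≤ 2 → ∀ m : ℕ, 1 ≤ m → ∀ F' : ℝ, 0 ≤ F' →
        |(1 + (δ - 1) * (-1 : ℝ) ^ m) *
              (roughCellDensity m (Real.log (xOf L N) / Real.log (zOf N u)) /
                (Real.log (xOf L N) / Real.log (zOf N u))) *
              (Real.exp Real.eulerMascheroniConstant *
                ∏ p ∈ Nat.primesBelow ⌈zOf N u⌉₊, (1 - sectionDensity Ψ i p)) * F' -
            (1 + (δ - 1) * (-1 : ℝ) ^ m) * modelDensity N u m * sectionH Ψ i * F'|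
          ≤ C * sectionH Ψ i * F' / Real.log N ^ 2

/-- **Main-term conversion from its two inputs** (`GeThreeMainTerm`; type of `stub_geThreeMainTerm`). -/
def GeThreeMainTerm : Prop :=
  SectionMertensTwo → ModelDensityAlladi → MainTermConversion

/-- **The assembly of the `u ≥ 3` rung** (`GeThreeAssembly`; type of `stub_geThreeAssembly`): the raw law
(applied to the localised body `K ∩ {ψ_i > x/Λ}` at `Bκ = B + t + D + 3`), the main-term conversion, the
`secSeqB` localisation costs (`≤ x/Λ + 1` on cells and fibre mass) and the landed preparations
(`PrLawTwoPrep`: degenerate primes / local obstructions ⇒ empty cells and vanishing model; values `≤ 2LN`;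
cells `≤` fibre mass; `EulerRatioIdentity` + `SingularRatioBound` for `H ≤ C (log log N)^D`;
`uniformRoughTupleBound` for `F ≤ C (log log N)^t N/log^t N`; `ModelDensityBounds` for `a_m ≤ C/log N`) give
Bombieri's `P_r` law for the sections at every `u ≥ 3` (small localised mass `< N/log^{t+2} N`: every cell
and the model are below the budget). -/
def GeThreeAssembly : Prop :=
  SectionSeqBFacts → SectionSeqBCells → MainTermConversion → PrLawTwoPrep → EulerRatioIdentity →
    (∀ t : ℕ, 1 ≤ t → SectionLevelAt t → RawSectionLawAt t) →
      ∀ t : ℕ, 1 ≤ t → SectionLevelAt t → ∀ u : ℕ, 3 ≤ u → SectionPrLawAtU u t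

/-- **The composition of the `u ≥ 3` rung** (`GeThreeComposeStep`; type of the bookkeeping stub
`stub_geThreeCompose`): kernel + glue give `stub_prLawGeThree`'s statement. Pure logic. -/
def GeThreeComposeStep : Prop :=
  EffectiveRoughCellLaw → SectionSeqBFacts → SectionSeqBCells → SectionDimension → SectionDimensionLow →
    SectionMertensLowerHead → (SectionMertensLowerHead → SectionMertensTwo) → ModelDensityAlladi →
      PrLawTwoPrep → EulerRatioIdentity → GeThreeHyp → GeThreeReduce → GeThreeMainTerm → GeThreeAssembly →
        ∀ t : ℕ, 1 ≤ t → SectionLevelAt t → ∀ u : ℕ, 3 ≤ u → SectionPrLawAtU u t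

/-- **`stub_geThreeCompose`** (registered bookkeeping stub of skeleton v13; pure logic). -/
theorem stub_geThreeCompose : GeThreeComposeStep :=
  fun hK hF hC hD hDl hLH hM2 hA hP hE hHyp hRed hMT hAsm =>
    hAsm hF hC (hMT (hM2 hLH) hA) hP hE (hRed hK (hHyp hF hC hD hDl))

end Summit.Parity.GeneralizedHardyLittlewood.Cruxes.CellParityLaw.SectionAnnihilator

end
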